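import Summits.QuantumAdvantage.QuantumAdvantage.Theorems.CubicForrelationNearExactIsExactTenPartner
import Summits.QuantumAdvantage.QuantumAdvantage.Theorems.CubicForrelationNearExactIsExactQuadWalshPlateau
import Literature.Computability.QuantumComplexity.ForrelationDirectSum

/-!
# Crux `CubicForrelation.NearExactIsExact` (stmt-QuantumAdvantage-14043) — the DERIVATIVE COUNT on the heavy hyperplane
(10 bits, `θ = 7/8`)

Seat `b2b-cforr-cert` (n = 10, θ = 7/8 certificate rung), file 4 of the computation-free proof.  HONEST FRAMING: a theorem
about cubic pairs on 10 bits — NOT summit progress.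

Setting as in `TenPartner`: `W_g = 16u`, `[u odd] = b₀ ⊕ c·x`, residual `τ = u − 2(−1)^f`, heavy hyperplane `H = {u even}`.
* `tz_inversion`: Walsh inversion `Σ_x W_G(x)(−1)^{x·y} = 2ⁿ G(y)`;
* `tz_fourier_link`: the residual of the pair is self-dual: `Σ_x τ(x)(−1)^{x·y} = −32·τ'(y)` with `τ' = u' − 2(−1)^g`,
  `W_f = 16u'`;
* `tz_count`: **the derivative count** — with `A_c := Σ_y (−1)^{g(y) ⊕ g(y ⊕ c)}` (the autocorrelation of `g` at the split
  covector), `2·(−1)^{b₀}·A_c = Σ_{x ∈ H} (4(−1)^{f(x)} τ(x) + τ(x)²)` (Parseval for the table `1_H · W_g/32`, whose transform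
  is `16((−1)^{g(y)} + (−1)^{b₀}(−1)^{g(y⊕c)})`);
* `tz_autocorr_sq`: `A_c = 0` or `A_c² = 4^s` (the derivative `D_c g` is quadratic: `stub_derivDegree`, `stub_quadWalshPlateau`);
* `tz_not_pow_four`: `9216 = 96²` and `25600 = 160²` are not powers of `4`.
Paper proof: seat folder `PROOF.md` §4.  References: C. Carlet, *Boolean Functions for Cryptography and Coding Theory*, CUP 2021,
§2.3 (Walsh transform, Parseval, autocorrelation); F. J. MacWilliams, N. J. A. Sloane (1977) Ch. 15 (Dickson).  Axioms: the
standard three.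
-/

set_option linter.dupNamespace false -- D-0017: single-problem summit ⇒ `QuantumAdvantage.QuantumAdvantage` by design

noncomputable section

namespace Summit.QuantumAdvantage.QuantumAdvantage.Theorems.CubicForrelation.NearExactIsExact

open Finset
open Literature.Computability.QuantumComplexity
open Literature.Computability.QuantumComplexity.BuzetChailloux (bxor zeroVec signOf_sq twist_zeroVec_right bxor_zeroVec
  twist_bxor_right)
open Literature.Computability.QuantumComplexity.DerivativeWalsh (W)

/-! ### Walsh inversion and the self-duality of the residual -/

/-- `Σ_x (−1)^{x·w} = 2ⁿ·[w = 0]` with the FIRST argument varying. [folklore] -/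
theorem tz_sum_twist_left {n : ℕ} (w : Fin n → Bool) :
    ∑ x : Fin n → Bool, twist x w = if w = (fun _ => false) then (2 : ℝ) ^ n else 0 := by
  rw [sum_congr rfl fun x _ => twist_comm x w, Simon.sum_twist]

/-- **Walsh inversion**: `Σ_x W_G(x)·(−1)^{x·y} = 2ⁿ·G(y)`. [cite: Carlet2020, §2.3] -/
theorem tz_inversion {n : ℕ} (G : (Fin n → Bool) → ℝ) (y : Fin n → Bool) :
    ∑ x, W G x * twist x y = (2 : ℝ) ^ n * G y := by
  have e : ∀ x : Fin n → Bool, W G x * twist x y = ∑ z, G z * twist x (bxor z y) := by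
    intro x
    rw [W, sum_mul]
    refine sum_congr rfl fun z _ => ?_
    rw [twist_bxor_right, twist_comm z x, mul_assoc]
  rw [sum_congr rfl fun x _ => e x, sum_comm]
  simp_rw [← mul_sum, tz_sum_twist_left]
  rw [sum_eq_single y]
  · have hy : bxor y y = (fun _ => false) := by
      funext i
      change (y i ^^ y i) = false
      cases y i <;> rfl
    rw [if_pos hy, mul_comm]
  · intro z _ hz
    rw [if_neg, mul_zero]
    intro h
    apply hz
    funext i
    have := congrFun h i
    change (z i ^^ y i) = false at this
    revert this
    cases z i <;> cases y i <;> simp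
  · intro h; exact absurd (mem_univ y) h

/-- **The residual is self-dual**: for any `f, g` on 10 bits with `W_g = 16u` and `W_f = 16u'`,
`Σ_x (u(x) − 2(−1)^{f(x)})(−1)^{x·y} = −32·(u'(y) − 2(−1)^{g(y)})`. [this work] -/
theorem tz_fourier_link (f g : (Fin (5 + 5) → Bool) → Bool) (u u' : (Fin (5 + 5) → Bool) → ℤ)
    (hu : ∀ x, W (fun y => signOf (g y)) x = (2 : ℝ) ^ 4 * (u x : ℝ))
    (hu' : ∀ y, W (fun x => signOf (f x)) y = (2 : ℝ) ^ 4 * (u' y : ℝ)) (y : Fin (5 + 5) → Bool) :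
    ∑ x, ((u x - 2 * sZ (f x) : ℤ) : ℝ) * twist x y = -32 * ((u' y - 2 * sZ (g y) : ℤ) : ℝ) := by
  have h1 := tz_inversion (fun z => signOf (g z)) y
  have h2 : ∑ x, signOf (f x) * twist x y = W (fun x => signOf (f x)) y := rfl
  have e : ∀ x : Fin (5 + 5) → Bool, ((u x - 2 * sZ (f x) : ℤ) : ℝ) * twist x y =
      (1 / 16) * (W (fun z => signOf (g z)) x * twist x y) - 2 * (signOf (f x) * twist x y) := by
    intro x
    push_cast
    rw [tp_sZ_cast, hu x]
    ring
  rw [sum_congr rfl fun x _ => e x, sum_sub_distrib, ← mul_sum, ← mul_sum, h1, h2, hu' y]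
  push_cast
  rw [tp_sZ_cast]
  ring

/-! ### The derivative count on the heavy hyperplane -/

/-- The indicator of the heavy hyperplane as a character average: `[u(x) even] = (1 + (−1)^{b₀}(−1)^{c·x})/2`. [folklore] -/
theorem tz_even_indicator (u : (Fin (5 + 5) → Bool) → ℤ) (c : Fin (5 + 5) → Bool) (b₀ : Bool)
    (hc : ∀ x, signOf (decide (Odd (u x))) = signOf b₀ * twist c x) (x : Fin (5 + 5) → Bool) :
    (if Odd (u x) then (0 : ℝ) else 1) = (1 + signOf b₀ * twist c x) / 2 := by
  rw [← hc x]
  unfold signOf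
  by_cases h : Odd (u x) <;> simp [h]

/-- **The derivative count.** For `f, g` on 10 bits with `W_g = 16u` and `[u odd] = b₀ ⊕ c·x`: with the residual
`τ = u − 2(−1)^f` and `A_c = Σ_y (−1)^{g(y) ⊕ g(y⊕c)}`,
`2·(−1)^{b₀}·A_c = Σ_{x : u(x) even} (4(−1)^{f(x)}τ(x) + τ(x)²)`.
(Parseval for `x ↦ [u(x) even]·W_g(x)/32`, whose Walsh transform is `16((−1)^{g(y)} + (−1)^{b₀}(−1)^{g(y⊕c)})`.)
[this work] -/
theorem tz_count (f g : (Fin (5 + 5) → Bool) → Bool) (u : (Fin (5 + 5) → Bool) → ℤ)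
    (hu : ∀ x, W (fun y => signOf (g y)) x = (2 : ℝ) ^ 4 * (u x : ℝ)) (c : Fin (5 + 5) → Bool) (b₀ : Bool)
    (hc : ∀ x, signOf (decide (Odd (u x))) = signOf b₀ * twist c x) (hc0 : c ≠ zeroVec) :
    2 * signOf b₀ * ∑ y, signOf (g y ^^ g (bxor y c)) =
      ∑ x ∈ univ.filter (fun x => ¬ Odd (u x)),
        (((4 * sZ (f x) * (u x - 2 * sZ (f x)) + (u x - 2 * sZ (f x)) ^ 2 : ℤ)) : ℝ) := by
  -- the table `F = 1_H · W_g / 32` and its Walsh transform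
  set F : (Fin (5 + 5) → Bool) → ℝ := fun x => (if Odd (u x) then (0 : ℝ) else 1) * (W (fun y => signOf (g y)) x / 32)
    with hF
  have hWF : ∀ y, W F y = 16 * (signOf (g y) + signOf b₀ * signOf (g (bxor y c))) := by
    intro y
    have h1 := tz_inversion (fun z => signOf (g z)) y
    have h2 := tz_inversion (fun z => signOf (g z)) (bxor c y)
    have e : ∀ x : Fin (5 + 5) → Bool, F x * twist x y =
        (1 / 64) * (W (fun z => signOf (g z)) x * twist x y) +
          (signOf b₀ / 64) * (W (fun z => signOf (g z)) x * twist x (bxor c y)) := by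
      intro x
      rw [hF]
      dsimp only
      rw [tz_even_indicator u c b₀ hc x, twist_bxor_right, twist_comm x c]
      ring
    rw [W, sum_congr rfl fun x _ => e x, sum_add_distrib, ← mul_sum, ← mul_sum, h1, h2, BuzetChailloux.bxor_comm c y]
    norm_num
    ring
  -- Parseval for `F`
  have hP := tb_sum_W_sq_mul_twist F zeroVec
  simp only [twist_zeroVec_right, mul_one, bxor_zeroVec] at hP
  -- left side: `Σ_y (W F y)² = 512·(1024 + (−1)^{b₀} A_c)`
  have hL : ∑ y, W F y ^ 2 = 512 * (1024 + signOf b₀ * ∑ y, signOf (g y ^^ g (bxor y c))) := by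
    have e : ∀ y : Fin (5 + 5) → Bool, W F y ^ 2 = 512 + 512 * (signOf b₀ * signOf (g y ^^ g (bxor y c))) := by
      intro y
      rw [hWF y, signOf_xor]
      have s1 := signOf_sq (g y)
      have s2 := signOf_sq (g (bxor y c))
      have s3 := signOf_sq b₀
      nlinarith [s1, s2, s3]
    rw [sum_congr rfl fun y _ => e y, sum_add_distrib, ← mul_sum, ← mul_sum, sum_const, card_univ, Fintype.card_fun,
      Fintype.card_bool, Fintype.card_fin, nsmul_eq_mul]
    norm_num
    ring
  -- right side: `Σ_x F(x)² = Σ_{u even} (u/2)²`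
  have hR : ∑ x, F x * F x = ∑ x ∈ univ.filter (fun x => ¬ Odd (u x)), ((u x : ℝ) / 2) ^ 2 := by
    rw [sum_filter]
    refine sum_congr rfl fun x _ => ?_
    rw [hF]
    dsimp only
    rw [hu x]
    by_cases h : Odd (u x)
    · rw [if_pos h, if_neg (not_not.2 h)]; ring
    · rw [if_neg h, if_pos h]; ring
  rw [hL, hR] at hP
  -- `(u/2)² = 1 + (−1)^f τ + τ²/4`
  have e2 : ∀ x : Fin (5 + 5) → Bool, ((u x : ℝ) / 2) ^ 2 =
      1 + (((4 * sZ (f x) * (u x - 2 * sZ (f x)) + (u x - 2 * sZ (f x)) ^ 2 : ℤ)) : ℝ) / 4 := by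
    intro x
    have hs : ((sZ (f x) : ℤ) : ℝ) ^ 2 = 1 := by rw [tp_sZ_cast]; exact signOf_sq _
    push_cast
    nlinarith [hs]
  rw [sum_congr rfl fun x _ => e2 x, sum_add_distrib, sum_const, ← sum_div, tp_card_even u c b₀ hc hc0,
    nsmul_eq_mul, mul_one, show (2 : ℝ) ^ (5 + 5) = 1024 by norm_num] at hP
  push_cast at hP ⊢
  linarith

/-! ### The autocorrelation at the split covector is `0` or `±2^s` -/

/-- For a cubic `g` and any `c`, the autocorrelation `A_c = Σ_y (−1)^{g(y) ⊕ g(y⊕c)}` is `0` or has `A_c² = 4^s`: the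
derivative `D_c g` has degree `≤ 2` (`stub_derivDegree`) and a quadratic has a plateaued Walsh spectrum
(`stub_quadWalshPlateau`, read at the zero character). [cite: MacWilliamsSloane1977, Ch. 15 §2 Thm. 4] -/
theorem tz_autocorr_sq (g : (Fin (5 + 5) → Bool) → Bool) (hg : IsDegLeFun 3 g) (c : Fin (5 + 5) → Bool) :
    ∑ y, signOf (g y ^^ g (bxor y c)) = 0 ∨ ∃ s : ℕ, (∑ y, signOf (g y ^^ g (bxor y c))) ^ 2 = (4 : ℝ) ^ s := by
  have hq : IsDegLeFun 2 (fun y => g y ^^ g (bxor y c)) := stub_derivDegree (5 + 5) 2 g c hg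
  obtain ⟨s, hs⟩ := stub_quadWalshPlateau (5 + 5) (fun y => g y ^^ g (bxor y c)) hq
  have h0 := hs zeroVec
  have e : W (fun y => signOf (g y ^^ g (bxor y c))) zeroVec = ∑ y, signOf (g y ^^ g (bxor y c)) := by
    rw [W]
    exact sum_congr rfl fun y _ => by rw [twist_zeroVec_right, mul_one]
  rw [e] at h0
  rcases h0 with h | h
  · exact Or.inl h
  · exact Or.inr ⟨s, h⟩

/-- `96² = 9216` and `160² = 25600` are not powers of `4`. [folklore] -/
theorem tz_not_pow_four (s : ℕ) : (4 : ℝ) ^ s ≠ 9216 ∧ (4 : ℝ) ^ s ≠ 25600 := by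
  have key : (4 : ℕ) ^ s ≠ 9216 ∧ (4 : ℕ) ^ s ≠ 25600 := by
    rcases Nat.lt_or_ge s 8 with h | h
    · interval_cases s <;> norm_num
    · have h8 : (4 : ℕ) ^ 8 ≤ 4 ^ s := Nat.pow_le_pow_right (by norm_num) h
      constructor <;> intro h' <;> rw [h'] at h8 <;> norm_num at h8
  constructor
  · intro h; apply key.1; exact_mod_cast h
  · intro h; apply key.2; exact_mod_cast h

end Summit.QuantumAdvantage.QuantumAdvantage.Theorems.CubicForrelation.NearExactIsExact

end
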